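import Summits.ResolutionOfSingularities.ResolutionOfSingularities.Theorems.FrobeniusClosingSteerMemberDerivations
import HarnessLib

/-!
# Crux `Steer` (stmt-ResolutionOfSingularities-16345), chain W4.1: (L7) members have ENOUGH DERIVATIONS, part 2 —
# residue kernel-exactness of the logarithmic frame derivations from a DUAL `p`-BASIS FRAME, and `H` from such a frame
# (Theses-free, def-free glue between res-L0-w41-stub-4's (L7-Ω) frame and part 1)

OURS (campaign `res-hironaka`, rung L ★L-G4, slot W4.1; statements about the route's own objects; NOT statements of the
manuscript under review [claim: Hironaka2017, status: under-review]; AI review is weaker than expert review). Seat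
res-D-pv-004 (AS res-L0-w41-stub-10); object (L7) of res-L0-w41-plan-1 RULING 84b. Part 1
(`FrobeniusClosingSteerMemberDerivations.lean`, p526306) proves `HasCleaningDerivations p S f g` for every regular local
`S` of characteristic `p` with an 𝔪-adapted frame `(x, Dx, D)` whose logarithmic part `D` is KERNEL-EXACT ON THE RESIDUE
FIELD in the shape «`(∀ l, D l c ∈ 𝔪) → ∃ b, c − b^p ∈ 𝔪`». res-L0-w41-stub-4's frame (L7-Ω, `exists_frame_int` of
`FrobeniusClosingSteerMemberDerivationFrame.lean`) delivers, for `S` regular local essentially of finite type over a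
PERFECT field, a regular system of parameters `x` with duals `dx`, lifts `u` of a `p`-basis `ū` of the residue field `κ`
with dual LOGARITHMIC derivations `du` (`du j (x i) = 0`, `du j (u j') = δ`), and the dual residue derivations `δ j` of
`ū` with `⋂ ker δ j = κ^p` and `κ = κ^p(ū)`. THIS FILE bridges the two shapes:

* `residue_apply_eq_of_dual_frame` — the residue class of `du j c` IS `δ j (residue c)` for every `c ∈ S`: the set of
  `y ∈ κ` on whose representatives this holds is a subfield (logarithmic derivations pass to representatives; Leibniz,
  inverses) containing `κ^p` (both sides vanish in characteristic `p`) and the `ū` (both are duals), hence is `κ`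
  (`Subfield.closure_induction` on stub-4's generation clause);
* `residue_kernelExact_of_dual_frame` — hence `(∀ j, du j c ∈ 𝔪) → ∃ b, c − b^p ∈ 𝔪`;
* `hasCleaningDerivations_of_dual_frame` — part 1 + the above: a dual `p`-basis frame ⇒ `HasCleaningDerivations p S f g`
  for all `f, g` (the hypotheses are LITERALLY the clauses of stub-4's `exists_frame_int`, so the final
  `hasCleaningDerivations_of_essFiniteType_perfect` (res-D-pv-003's binder `hL7`) is a one-line instantiation once
  (L7-Ω) is in the tree — part 3).

No Theses file is imported; nothing here is a route item or a registration. [cite: Matsumura1987, Thm. 26.5, Thm. 30.6]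
-/

noncomputable section

-- `Summit.<S>.<S>.…` duplicates the summit name by design (single-problem summit).
set_option linter.dupNamespace false

open IsLocalRing

namespace Summit.ResolutionOfSingularities.ResolutionOfSingularities.Theorems.SwitchingDichotomy.MemberDerivations

universe u

/-! ## §4 Logarithmic derivations pass to the residue field; agreement with the dual residue derivations -/

section Residue

variable {S : Type u} [CommRing S] [IsLocalRing S] (p : ℕ) [hp : Fact p.Prime] [CharP S p]

omit hp [CharP S p] in
/-- A derivation mapping a generating set of `𝔪` into `𝔪` is LOGARITHMIC (`D 𝔪 ⊆ 𝔪`). [folklore] -/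
theorem map_maximalIdeal_of_generators {d : ℕ} (x : Fin d → S)
    (hx : Ideal.span (Set.range x) = maximalIdeal S) (E : Derivation ℤ S S)
    (hE : ∀ j, E (x j) ∈ maximalIdeal S) : ∀ y ∈ maximalIdeal S, E y ∈ maximalIdeal S := by
  have hxi : ∀ i, x i ∈ maximalIdeal S := fun i => hx ▸ Ideal.subset_span ⟨i, rfl⟩
  intro y hy
  rw [← hx, Ideal.mem_span_range_iff_exists_fun] at hy
  obtain ⟨c, rfl⟩ := hy
  rw [map_sum]
  refine Ideal.sum_mem _ fun i _ => ?_
  rw [E.leibniz, smul_eq_mul, smul_eq_mul]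
  exact Ideal.add_mem _ (Ideal.mul_mem_left _ _ (hE i)) (Ideal.mul_mem_right _ _ (hxi i))

omit hp [CharP S p] in
/-- A logarithmic derivation is constant on residue classes modulo `𝔪`, read in the residue field. [folklore] -/
theorem residue_apply_eq_of_sub_mem (E : Derivation ℤ S S) (hlog : ∀ y ∈ maximalIdeal S, E y ∈ maximalIdeal S)
    {c c' : S} (h : c - c' ∈ maximalIdeal S) : residue S (E c) = residue S (E c') := by
  rw [← sub_eq_zero, ← map_sub, ← map_sub, residue_eq_zero_iff]
  exact hlog _ h

/-- **Agreement of the induced residue derivation with the dual residue derivation.** Let `du` be a LOGARITHMIC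
derivation of the local ring `S` (characteristic `p`) and `δ` a derivation of the residue field `κ`, and suppose they
agree on lifts `u j'` of a family `ū` (`residue (du (u j')) = δ (ū j')`) and that `κ` is generated as a field by `κ^p`
and the `ū`. Then `residue (du c) = δ (residue c)` for EVERY `c ∈ S`. [cite: Matsumura1987, Thm. 26.5] -/
theorem residue_apply_eq_of_dual_frame {e : ℕ} (u : Fin e → S)
    (δ : Derivation ℤ (ResidueField S) (ResidueField S)) (du : Derivation ℤ S S)
    (hgen : Subfield.closure (Set.range (fun y : ResidueField S => y ^ p) ∪
      Set.range (fun j => residue S (u j))) = ⊤)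
    (hlog : ∀ y ∈ maximalIdeal S, du y ∈ maximalIdeal S)
    (hagree : ∀ j', residue S (du (u j')) = δ (residue S (u j'))) (c : S) :
    residue S (du c) = δ (residue S c) := by
  haveI : CharP (ResidueField S) p := charP_residueField p hp.out
  -- the property «on every representative», which is well defined by `residue_apply_eq_of_sub_mem`
  suffices key : ∀ y : ResidueField S, ∀ c : S, residue S c = y → residue S (du c) = δ y from key _ c rfl
  have hwd : ∀ {c c' : S}, residue S c = residue S c' → residue S (du c) = residue S (du c') := by
    intro c c' h
    exact residue_apply_eq_of_sub_mem du hlog ((Ideal.Quotient.eq).mp h)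
  intro y
  have hy : y ∈ Subfield.closure (Set.range (fun y : ResidueField S => y ^ p) ∪
      Set.range (fun j => residue S (u j))) := by rw [hgen]; exact Subfield.mem_top y
  induction hy using Subfield.closure_induction with
  | mem z hz =>
    intro c hc
    rcases hz with ⟨t, rfl⟩ | ⟨j', rfl⟩
    · -- `p`-th powers: both sides vanish
      obtain ⟨s, rfl⟩ := residue_surjective t
      have hc' : residue S c = residue S (s ^ p) := by simp only [hc, map_pow]
      show residue S (du c) = δ (residue S s ^ p)
      rw [hwd hc', du.leibniz_pow, ← Nat.cast_smul_eq_nsmul S p, CharP.cast_eq_zero S p, zero_smul,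
        map_zero, δ.leibniz_pow, ← Nat.cast_smul_eq_nsmul (ResidueField S) p, CharP.cast_eq_zero,
        zero_smul]
    · show residue S (du c) = δ (residue S (u j'))
      rw [hwd hc, hagree]
  | one =>
    intro c hc
    rw [← (residue S).map_one] at hc
    rw [hwd hc, du.map_one_eq_zero, map_zero, δ.map_one_eq_zero]
  | add z w _ _ hz hw =>
    intro c hc
    obtain ⟨c₁, rfl⟩ := residue_surjective z
    have hc₂ : residue S (c - c₁) = w := by rw [map_sub, hc, add_sub_cancel_left]
    have := hw (c - c₁) hc₂
    rw [map_sub, map_sub, sub_eq_iff_eq_add] at this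
    rw [this, hz c₁ rfl, map_add, add_comm]
  | neg z _ hz =>
    intro c hc
    have hc' : residue S (-c) = z := by rw [map_neg, hc, neg_neg]
    have := hz (-c) hc'
    rw [map_neg, map_neg, neg_eq_iff_eq_neg] at this
    rw [this, map_neg]
  | inv z _ hz =>
    intro c hc
    by_cases hz0 : z = 0
    · subst hz0
      rw [inv_zero] at hc
      rw [← (residue S).map_zero] at hc
      rw [hwd hc, map_zero, map_zero, inv_zero, map_zero]
    · obtain ⟨c₁, hc₁⟩ := residue_surjective z
      -- `c · c₁ ≡ 1`
      have h1 : residue S (c * c₁) = residue S 1 := by rw [map_mul, hc, hc₁, map_one, inv_mul_cancel₀ hz0]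
      have h2 := hwd h1
      rw [du.map_one_eq_zero, map_zero, du.leibniz, smul_eq_mul, smul_eq_mul, map_add, map_mul,
        map_mul, hc, hc₁, hz c₁ hc₁] at h2
      -- `z⁻¹ · δ z + z · r = 0` with `r = residue (du c)`; and `δ z⁻¹ = - z⁻¹ ^ 2 · δ z`
      have hinv : δ z⁻¹ = -(z⁻¹ * z⁻¹ * δ z) := by
        have h3 := δ.leibniz z z⁻¹
        rw [mul_inv_cancel₀ hz0, δ.map_one_eq_zero, smul_eq_mul, smul_eq_mul] at h3
        -- `0 = z * δ z⁻¹ + z⁻¹ * δ z`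
        have h4 : z * δ z⁻¹ = -(z⁻¹ * δ z) := by linear_combination h3.symm
        have h5 : δ z⁻¹ = z⁻¹ * (z * δ z⁻¹) := by rw [← mul_assoc, inv_mul_cancel₀ hz0, one_mul]
        rw [h5, h4]; ring
      rw [hinv]
      have h6 : z * residue S (du c) = -(z⁻¹ * δ z) := by linear_combination h2
      have h7 : residue S (du c) = z⁻¹ * (z * residue S (du c)) := by
        rw [← mul_assoc, inv_mul_cancel₀ hz0, one_mul]
      rw [h7, h6]; ring
  | mul z w _ _ hz hw =>
    intro c hc
    obtain ⟨c₁, hc₁⟩ := residue_surjective z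
    obtain ⟨c₂, hc₂⟩ := residue_surjective w
    have h1 : residue S c = residue S (c₁ * c₂) := by rw [map_mul, hc₁, hc₂, hc]
    rw [hwd h1, du.leibniz, smul_eq_mul, smul_eq_mul, map_add, map_mul, map_mul, hc₁, hc₂, hz c₁ hc₁,
      hw c₂ hc₂, δ.leibniz, smul_eq_mul, smul_eq_mul]

/-- **Residue kernel-exactness of the logarithmic frame derivations** (the `hker` hypothesis of part 1's
`exists_sub_pow_mem_pow_succ_of_frame`) from a DUAL `p`-BASIS FRAME (the clauses of res-L0-w41-stub-4's
`MemberDerivationFrame.exists_frame_int`): if `κ = κ^p(ū)`, the residue derivations `δ j` are dual to `ū` with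
`⋂ ker δ j = κ^p`, and the logarithmic `du j` are dual to the lifts `u`, then `(∀ j, du j c ∈ 𝔪) → ∃ b, c − b^p ∈ 𝔪`.
[cite: Matsumura1987, Thm. 26.5] -/
theorem residue_kernelExact_of_dual_frame {e : ℕ} (u : Fin e → S)
    (δ : Fin e → Derivation ℤ (ResidueField S) (ResidueField S)) (du : Fin e → Derivation ℤ S S)
    (hgen : Subfield.closure (Set.range (fun y : ResidueField S => y ^ p) ∪
      Set.range (fun j => residue S (u j))) = ⊤)
    (hδu : ∀ j j', δ j (residue S (u j')) = if j' = j then 1 else 0)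
    (hδker : ∀ y : ResidueField S, (∀ j, δ j y = 0) ↔ ∃ t, t ^ p = y)
    (hdulog : ∀ j, ∀ y ∈ maximalIdeal S, du j y ∈ maximalIdeal S)
    (hduu : ∀ j j', du j (u j') = if j' = j then 1 else 0) :
    ∀ c : S, (∀ j, du j c ∈ maximalIdeal S) → ∃ b : S, c - b ^ p ∈ maximalIdeal S := by
  intro c hc
  have hzero : ∀ j, δ j (residue S c) = 0 := by
    intro j
    rw [← residue_apply_eq_of_dual_frame p u (δ j) (du j) hgen (hdulog j) (fun j' => ?_) c]
    · exact (residue_eq_zero_iff _).mpr (hc j)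
    · rw [hduu, hδu]
      split_ifs <;> simp
  obtain ⟨t, ht⟩ := (hδker _).mp hzero
  obtain ⟨b, rfl⟩ := residue_surjective t
  refine ⟨b, ?_⟩
  rw [← residue_eq_zero_iff, map_sub, map_pow, ht, sub_self]

end Residue

/-! ## §5 `H` from a dual `p`-basis frame (part 1 + §4) -/

section DualFrame

variable {S : Type u} [CommRing S] [IsRegularLocalRing S] (p : ℕ) [hp : Fact p.Prime] [CharP S p]

/-- **(L7, dual-frame form)**: a regular local ring `S` of characteristic `p` carrying a DUAL `p`-BASIS FRAME — a minimal
system of generators `x : Fin c → S` of `𝔪` (`c = embdim`) with dual derivations `dx`, lifts `u` of a `p`-basis `ū` of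
the residue field `κ` (`κ = κ^p(ū)`) with dual residue derivations `δ` (`⋂ ker δ = κ^p`) and dual LOGARITHMIC
derivations `du` (`du j (x i) = 0`) — satisfies `H`: for all `f g N`, if no `h` cleans `f` into `𝔪^(N+1)` while
`f − g^p ∈ 𝔪^N`, some derivation `D : S → S` has `D f ∉ 𝔪^N` or is logarithmic with `D f ∉ 𝔪^(N+1)`. The hypotheses
are the clauses of res-L0-w41-stub-4's `exists_frame_int` verbatim. [cite: Matsumura1987, Thm. 17.10, Thm. 26.5] -/
theorem hasCleaningDerivations_of_dual_frame {c : ℕ} (hc : (maximalIdeal S).spanFinrank = c) (x : Fin c → S)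
    (hx : Ideal.span (Set.range x) = maximalIdeal S) {e : ℕ} (u : Fin e → S)
    (δ : Fin e → Derivation ℤ (ResidueField S) (ResidueField S)) (dx : Fin c → Derivation ℤ S S)
    (du : Fin e → Derivation ℤ S S)
    (hgen : Subfield.closure (Set.range (fun y : ResidueField S => y ^ p) ∪
      Set.range (fun j => residue S (u j))) = ⊤)
    (hδu : ∀ j j', δ j (residue S (u j')) = if j' = j then 1 else 0)
    (hδker : ∀ y : ResidueField S, (∀ j, δ j y = 0) ↔ ∃ t, t ^ p = y)
    (hdx : ∀ i i', dx i (x i') = if i' = i then 1 else 0)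
    (hdux : ∀ j i, du j (x i) = 0) (hduu : ∀ j j', du j (u j') = if j' = j then 1 else 0)
    (f g : S) (N : ℕ) (hopt : ∀ h : S, f - h ^ p ∉ maximalIdeal S ^ (N + 1))
    (hfg : f - g ^ p ∈ maximalIdeal S ^ N) :
    ∃ Dr : Derivation ℤ S S, Dr f ∉ maximalIdeal S ^ N ∨
      ((∀ y ∈ maximalIdeal S, Dr y ∈ maximalIdeal S) ∧ Dr f ∉ maximalIdeal S ^ (N + 1)) := by
  have hdulog : ∀ j, ∀ y ∈ maximalIdeal S, du j y ∈ maximalIdeal S := fun j =>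
    map_maximalIdeal_of_generators x hx (du j) fun i => by rw [hdux]; exact zero_mem _
  exact hasCleaningDerivations_of_frame p hc x hx dx (fun i j => by rw [hdx]; simp only [eq_comm]) du hdulog
    (residue_kernelExact_of_dual_frame p u δ du hgen hδu hδker hdulog hduu) f g N hopt hfg

/-- The same in res-L0-w41-strat-2's word, for a regular local member `S ⊆ L` of a field of characteristic `p`.
[cite: Matsumura1987, Thm. 17.10, Thm. 26.5] -/
theorem hasCleaningDerivations_of_dual_frame_subring {L : Type} [Field L] [CharP L p] (S : Subring L)
    [IsRegularLocalRing S] {c : ℕ} (hc : (maximalIdeal S).spanFinrank = c) (x : Fin c → S)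
    (hx : Ideal.span (Set.range x) = maximalIdeal S) {e : ℕ} (u : Fin e → S)
    (δ : Fin e → Derivation ℤ (ResidueField S) (ResidueField S)) (dx : Fin c → Derivation ℤ S S)
    (du : Fin e → Derivation ℤ S S)
    (hgen : Subfield.closure (Set.range (fun y : ResidueField S => y ^ p) ∪
      Set.range (fun j => residue S (u j))) = ⊤)
    (hδu : ∀ j j', δ j (residue S (u j')) = if j' = j then 1 else 0)
    (hδker : ∀ y : ResidueField S, (∀ j, δ j y = 0) ↔ ∃ t, t ^ p = y)
    (hdx : ∀ i i', dx i (x i') = if i' = i then 1 else 0)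
    (hdux : ∀ j i, du j (x i) = 0) (hduu : ∀ j j', du j (u j') = if j' = j then 1 else 0) (f g : S) :
    HasCleaningDerivations p S f g :=
  fun N hopt hfg => hasCleaningDerivations_of_dual_frame p hc x hx u δ dx du hgen hδu hδker hdx hdux hduu f g N hopt hfg

end DualFrame

end Summit.ResolutionOfSingularities.ResolutionOfSingularities.Theorems.SwitchingDichotomy.MemberDerivations

end
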